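import Literature.AnabelianGeometry.EtaleTheta.KummerContH1
import Literature.AnabelianGeometry.EtaleTheta.ContH1ConjAction
import HarnessLib

/-!
# Continuous Kummer classes are equivariant for the conjugation action on `H¹`

Proof-only companion (no definitions) of `KummerContH1.lean` (abc-iut-L2-t12) and
`ContH1ConjAction.lean` (abc-iut-L6-t12), layer L2 of the abc-iut cell (seat abc-iut-w5-d125; sub-DAG
`plan/L2/SUBDAG-EtTh-Prop14.md`, row P14/L08 «class-level form of Prop. 1.4 (ii)»).

[EtTh] (S. Mochizuki, *The étale theta function …*, Publ. RIMS **45** (2009)) §1 lets `Π^tp_X` act on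
`H¹(Π^tp_Ÿ, Δ_Θ)` by conjugation and transports the étale theta class along deck transformations: the
proof of Prop. 1.4 (iii) (PRIMS p. 248: "assertion (iii) is a formal consequence of the construction of
the classes `O^×_K̈ · η̈^Θ`") and Def. 1.9 / Rmk. 1.9.1 (p. 255: the orbit `η̈^{Θ,ℤ}`) use that the Kummer
class of the PULLED-BACK function `σ^* f` is the CONJUGATE `σ · κ(f)` of the Kummer class of `f`. For the
tree's carriers — `CyclotomeCoefficients.kummerContClass` (continuous Kummer class of a compatible root
system, `KummerContH1.lean`) and `ContH1.conj` (conjugation on continuous `H¹`, `ContH1.lean`) — this is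
the following identity, PROVED here at the level of cocycles (no coboundary correction is needed):

* `CyclotomeCoefficients.conj_kummerContClass` — for `H` normal in `G`, `σ ∈ G` and a compatible root
  system `x` of the `H`-invariant `a` with open stabilisers,
  `ContH1.conj φ A' σ (κ(x)) = κ(σ • x)`, where `σ • x = x.smul σ` is the transported root system of
  `σ • a` ([cite: LANA2026Report, §6.1 p.31] "`κ` is `G`-equivariant", cochain form
  `RootSystem.kummerCocycle_smul_conj`);
* `CyclotomeCoefficients.conj_kummerContClass_of_smul_eq` — the form consumers use: if `σ • a = b`
  then `σ · κ(a) = κ(b)` for the classes computed from ANY root systems of `a`, `b`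
  (independence of the root system, `kummerContClass_eq`);
* `CyclotomeCoefficients.conj_kummerContClass_of_mem_stabilizer` — if `σ` fixes `a`, then `σ` fixes
  its Kummer class.

Classical ([cite: NeukirchSchmidtWingberg2008, I §5]); nothing here is specific to the disputed parts of
the IUT corpus; no statement of [EtTh] is asserted.
-/

namespace Literature.AnabelianGeometry.EtaleTheta

namespace CyclotomeCoefficients

variable {G G' : Type*} [Group G] [TopologicalSpace G] [IsTopologicalGroup G]
  [Group G'] [TopologicalSpace G'] [IsTopologicalGroup G']
  {φ : G →* G'} {A' : Subgroup G'} [A'.Normal] [IsMulCommutative A']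
  {A : Type*} [CommGroup A] [MulDistribMulAction G A] [TopologicalSpace A]
  (c : CyclotomeCoefficients φ A' A) (H : Subgroup G) [H.Normal] {a b : A}

omit [TopologicalSpace G] [IsTopologicalGroup G] [TopologicalSpace A] in
/-- If `a` is `H`-invariant and `H` is normal, then `σ • a` is `H`-invariant (`h σ a = σ (σ⁻¹ h σ) a`).
[cite: NeukirchSchmidtWingberg2008, I §5] -/
theorem smul_mem_fixedPoints_of_normal (σ : G) (ha : a ∈ MulAction.fixedPoints H A) :
    σ • a ∈ MulAction.fixedPoints H A := by
  intro h
  have hmem : σ⁻¹ * (h : G) * σ ∈ H := by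
    have := Subgroup.Normal.conj_mem inferInstance (h : G) h.2 σ⁻¹
    simpa using this
  have hfix : (σ⁻¹ * (h : G) * σ) • a = a := ha ⟨_, hmem⟩
  change (h : G) • σ • a = σ • a
  calc (h : G) • σ • a = σ • ((σ⁻¹ * (h : G) * σ) • a) := by
          rw [smul_smul, smul_smul]
          congr 1
          group
    _ = σ • a := by rw [hfix]

/-- **Equivariance of the continuous Kummer class** (cocycle-level identity): conjugating the Kummer
class of the root system `x` of `a` by `σ ∈ G` gives the Kummer class of the transported root system
`σ • x` of `σ • a`: `(σ·κ_x)(h) = φ(σ) c((σ⁻¹hσ • x_n / x_n)_n) φ(σ)⁻¹ = c(σ • (σ⁻¹hσ • x_n / x_n)_n)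
= c((h • σx_n / σx_n)_n) = κ_{σ•x}(h)`. [cite: NeukirchSchmidtWingberg2008, I §5] -/
theorem conj_kummerContClass (σ : G) (x : RootSystem a) (ha : a ∈ MulAction.fixedPoints H A)
    (hx : ∀ n : ℕ+, IsOpen (MulAction.stabilizer G (x.root n) : Set G))
    (hσa : σ • a ∈ MulAction.fixedPoints H A)
    (hσx : ∀ n : ℕ+, IsOpen (MulAction.stabilizer G ((x.smul σ).root n) : Set G)) :
    ContH1.conj φ A' σ (c.kummerContClass H x ha hx) = c.kummerContClass H (x.smul σ) hσa hσx := by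
  rw [kummerContClass, kummerContClass, ContH1.mk, ContH1.mk, ContH1.conj_mk]
  congr 1
  apply Subtype.ext
  funext h
  rw [ContH1.conjCocycle_apply]
  change MulAut.conjNormal (φ σ) (c.hom (x.kummerCocycle ha (MulAut.conjNormal σ⁻¹ h))) =
    c.hom ((x.smul σ).kummerCocycle hσa h)
  rw [← c.hom_smul]
  congr 1
  refine Subtype.ext (funext fun n => ?_)
  change σ • (((MulAut.conjNormal σ⁻¹ h : H) : G) • x.root n / x.root n) =
    (h : G) • (σ • x.root n) / (σ • x.root n)
  rw [smul_div', smul_smul, smul_smul]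
  congr 2
  simp only [MulAut.conjNormal_apply, inv_inv]
  group

/-- Equivariance in the form used downstream: if `σ • a = b` (e.g. the pull-back of a function along a
deck transformation is a known function), then conjugation by `σ` carries the Kummer class of `a` to the
Kummer class of `b`, each computed from any compatible root system with open stabilisers.
[cite: NeukirchSchmidtWingberg2008, I §5] -/
theorem conj_kummerContClass_of_smul_eq (σ : G) (x : RootSystem a) (y : RootSystem b)
    (ha : a ∈ MulAction.fixedPoints H A) (hb : b ∈ MulAction.fixedPoints H A)
    (hx : ∀ n : ℕ+, IsOpen (MulAction.stabilizer G (x.root n) : Set G))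
    (hy : ∀ n : ℕ+, IsOpen (MulAction.stabilizer G (y.root n) : Set G))
    (hσx : ∀ n : ℕ+, IsOpen (MulAction.stabilizer G ((x.smul σ).root n) : Set G))
    (hab : σ • a = b) :
    ContH1.conj φ A' σ (c.kummerContClass H x ha hx) = c.kummerContClass H y hb hy := by
  subst hab
  rw [c.conj_kummerContClass H σ x ha hx hb hσx]
  exact c.kummerContClass_eq H _ _ hb _ _

omit [TopologicalSpace A] [H.Normal] in
/-- The stabiliser of the root transported by `σ` is the conjugate of the stabiliser, hence open if the
latter is. [cite: NeukirchSchmidtWingberg2008, I §5] -/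
theorem isOpen_stabilizer_smul_root (σ : G) (x : RootSystem a)
    (hx : ∀ n : ℕ+, IsOpen (MulAction.stabilizer G (x.root n) : Set G)) (n : ℕ+) :
    IsOpen (MulAction.stabilizer G ((x.smul σ).root n) : Set G) := by
  rw [RootSystem.smul_root, MulAction.stabilizer_smul_eq_stabilizer_map_conj]
  have hcont : Continuous fun g : G => σ⁻¹ * g * σ⁻¹⁻¹ := by fun_prop
  have heq : ((MulAction.stabilizer G (x.root n)).map (MulAut.conj σ).toMonoidHom : Set G) =
      (fun g : G => σ⁻¹ * g * σ⁻¹⁻¹) ⁻¹' (MulAction.stabilizer G (x.root n) : Set G) := by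
    ext g
    simp only [Subgroup.coe_map, MulEquiv.coe_toMonoidHom, MulAut.conj_apply, Set.mem_image,
      SetLike.mem_coe, Set.mem_preimage, inv_inv]
    constructor
    · rintro ⟨y, hy, rfl⟩
      simpa [mul_assoc] using hy
    · intro hg
      exact ⟨σ⁻¹ * g * σ, hg, by group⟩
  rw [heq]
  exact hx n |>.preimage hcont

/-- If `σ` fixes `a`, then conjugation by `σ` fixes the Kummer class of `a` (the case of deck
transformations under which the function is invariant). [cite: NeukirchSchmidtWingberg2008, I §5] -/
theorem conj_kummerContClass_of_mem_stabilizer (σ : G) (x : RootSystem a)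
    (ha : a ∈ MulAction.fixedPoints H A)
    (hx : ∀ n : ℕ+, IsOpen (MulAction.stabilizer G (x.root n) : Set G)) (hσ : σ • a = a) :
    ContH1.conj φ A' σ (c.kummerContClass H x ha hx) = c.kummerContClass H x ha hx :=
  c.conj_kummerContClass_of_smul_eq H σ x x ha ha hx hx (isOpen_stabilizer_smul_root σ x hx) hσ

end CyclotomeCoefficients

end Literature.AnabelianGeometry.EtaleTheta
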